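import Summits.CriticalPhenomena.PercolationContinuityZ3.Theorems.PercNearOneGluingNoHeavyLowerTailMajorityGluingTypeTableFixedM
import Summits.CriticalPhenomena.PercolationContinuityZ3.Theorems.PercNearOneGluingNoHeavyLowerTailMajorityGluingTypeTableClasses
import Summits.CriticalPhenomena.PercolationContinuityZ3.Theorems.PercNearOneGluingNoHeavyLowerTailMajorityGluingConvexBootstrapRpowCert
import Summits.CriticalPhenomena.PercolationContinuityZ3.Theorems.PercNearOneGluingNoHeavyLowerTailMajorityGluingConvexBootstrapTangent
import HarnessLib

/-!
# The fixed-`M` programme in the kernel, template B (data and constants): ISO tangent rows on the dyadic grid `2^{i/32}`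
(lane prim-rate, constants-miner 1, gen 28; KERNEL-WINDOW.md §1–§4; CONVEX-BOOTSTRAP.md §5 «progM2»; RIGOROUS-CERTIFICATION.md §1)

Support file for the closed crux `NoHeavyLowerTail` (stmt-CriticalPhenomena-4575), majority-gluing line; continuation of
`…TypeTableFixedM` (template A: the linear rows of a case as checkable data and `fixedM_sound`).  Template B adds the
`M`-dependent rows: the Kelley cuts (tangents) of the ISO₃ / ISO₄ power rows.  The power rows of the programme are,
for a law `x ≥ 0` at hub weight `M`,
`u_{0ab}^{c₃} ≤ M^{3−c₃}·ρ₀·π_{a¬b}·π_{b¬a}`, `u_{abc}^{c₃} ≤ M^{3−c₃}·ρ_a ρ_b ρ_c`, `U₄^{c₄} ≤ M^{4−c₄}·Π_z(S_z+T_z)`,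
`u_{0abc}^{c₄} ≤ M^{4−c₄}·ρ₀ρ_aρ_bρ_c`, `u_{01234}^{5/2} ≤ M^{5/2}·Π_tρ_t` (`c₃ = (3+√3)/2`, `c₄ = (3+√(11/3))/2`).  Bounding all
but two factors (`ρ₀ ≤ 1`, relay-triple `ρ ≤ 2`, `S_z+T_z ≤ 2`, hub-set `ρ ≤ 1` by the budgets)
and extracting the root gives `u ≤ C·(s·t)^q` with `q = 1/c` and `C = (M^{b}R)^{q}`; by concavity (`2q ≤ 1`) every
tangent `u ≤ h + g₁s + g₂t` at a support point `(a,b)` is a valid LINEAR row (`ConvexBootstrap.tangent_two_rounded`).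

THE DEVICE OF THIS FILE: hub weights and support points are taken on the grid `2^{m/32}` (`M ≤ 2^{−k/32}`,
`a = 2^{i/32}`, `b = 2^{j/32}`).  Then EVERY irrational constant of every cut is a monomial in three numbers
`η = 2^{1/32}`, `θ₃ = 2^{q₃/32}`, `θ₄ = 2^{p/32}` and the algebraic `λ = 2^{1/80}` (`M^{2−√3} = θ₃^{−3k}η^{k}`, `2^{q₃} = θ₃^{32}`,
`(ab)^{q₃} = θ₃^{i+j}`, `1/a = η^{−i}`, `M^{κ₀} = θ₄^{−4k}η^{k}`, `4^{p} = θ₄^{64}`, `(ab)^{2/5} = λ^{i+j}`), bracketed ONCE by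
rationals (`eta_bounds`, `theta3_bounds`, `theta4_bounds`, `lam_bounds`: `RpowCert.rpow_le_cert` + `decide`).  A cut is then checked in `ℚ`
(`TRow.ok`) with no real power evaluated, and a whole programme by ONE `decide` (`checkFMB`).  This file: the data
(`PKind`, `TRow`, `BRow`, `checkFMB`), the brackets and their certification, the grid lemmas (`le_powUp`, `grid_le`,
`scaled_const_le`, `iso5_const_le`, `supp_pow_le`, `inv_supp_le`, `R_pow_le`).  The generic real step from a power row to a
checked cut and the support bounds are in `…TypeTableFixedMSupp`, the law-level family theorem `fixedMB_sound` in
`…TypeTableFixedMIso`.  Precision affects tightness only, never validity.  No percolation, no sorries.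
[cite: VandenbergHaggstromKahn2005, Thm. 1.3 (p. 6)]
-/

namespace Summit.CriticalPhenomena.PercolationContinuityZ3.Theorems

namespace HubOnly
namespace TypeTable

open DType

/-! ### The grid constants and their rational brackets -/

/-- Lower bracket of `η = 2^{1/32}` (13 digits). -/
def ETAL : ℚ := 10218971486541 / 10 ^ 13
/-- Upper bracket of `η = 2^{1/32}`. -/
def ETAU : ℚ := 10218971486542 / 10 ^ 13
/-- Lower bracket of `θ₃ = 2^{q₃/32}`, `q₃ = 2/(3+√3)` (from `101/7647 ≤ q₃/32`). -/
def TH3L : ℚ := 10091969797945 / 10 ^ 13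
/-- Upper bracket of `θ₃` (from `q₃/32 ≤ 94/7117`). -/
def TH3U : ℚ := 10091969926479 / 10 ^ 13
/-- Lower bracket of `θ₄ = 2^{p/32}`, `p = 2/(3+√(11/3))` (from `69/5426 ≤ p/32`). -/
def TH4L : ℚ := 10088534023141 / 10 ^ 13
/-- Upper bracket of `θ₄` (from `p/32 ≤ 80/6291`). -/
def TH4U : ℚ := 10088534228000 / 10 ^ 13
/-- Lower bracket of `λ = 2^{1/80}` (the ISO₅ support constant: `(ab)^{2/5} = λ^{i+j}`). -/
def LAML : ℚ := 10087019837903 / 10 ^ 13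
/-- Upper bracket of `λ = 2^{1/80}`. -/
def LAMU : ℚ := 10087019837904 / 10 ^ 13
/-- Rational brackets of `q₃` (= `RpowCert.inv_c3_bounds`). -/
def QL3 : ℚ := 422649730810 / 10 ^ 12
/-- see `QL3` -/
def QU3 : ℚ := 422649730811 / 10 ^ 12
/-- Rational brackets of `p = 1/c₄` (= `RpowCert.inv_c4_bounds`). -/
def QL4 : ℚ := 406929669182 / 10 ^ 12
/-- see `QL4` -/
def QU4 : ℚ := 406929669183 / 10 ^ 12

/-- Certified upper bound of `x^m` (`m ∈ ℤ`) for a real `x ∈ [lo, hi]`, `lo > 0`. -/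
def powUp (lo hi : ℚ) (m : ℤ) : ℚ := if 0 ≤ m then hi ^ m.toNat else (lo ^ (-m).toNat)⁻¹

/-! ### Power-row kinds, tangent rows, the programme check -/

/-- The power rows of the programme: hub triple `{0,a,b}` (`a<b`; supports `π_{a¬b}, π_{b¬a}`; `ρ₀ ≤ 1`), relay triple
`{a,b,c}` (`a<b<c`) with the support `ρ_f` bounded by `2` and the other two as supports, ISO₄ of `{1,2,3,4}` with
supports `S_a+T_a`, `S_b+T_b` (`a<b`; the other two factors `≤ 2`), hub 4-set `{0,a,b,c}` (`a<b<c`; `ρ₀, ρ_f ≤ 1`, the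
other two relay supports), and ISO₅ of `{0,1,2,3,4}` with relay supports `ρ_a, ρ_b` (`a<b`; the other three factors `≤ 1`). -/
inductive PKind where
  /-- hub ISO₃ row of the hub triple `{0, a, b}`, `a < b` -/
  | hub3 (a b : ℕ)
  /-- relay ISO₃ row of `{a, b, c}`, `a < b < c`, with the support `ρ_f` bounded by `2` -/
  | rel3 (a b c f : ℕ)
  /-- the ISO₄ row of `{1,2,3,4}` with supports `S_a + T_a`, `S_b + T_b`, `a < b` -/
  | iso4 (a b : ℕ)
  /-- hub ISO₄ row of `{0, a, b, c}`, `a < b < c`, with `ρ₀` and `ρ_f` bounded by `1` -/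
  | hub4 (a b c f : ℕ)
  /-- the ISO₅ row of `{0,1,2,3,4}` with relay supports `ρ_a, ρ_b`, `a < b` -/
  | iso5 (a b : ℕ)

/-- The two points of `a<b<c` other than `f`. -/
def others3 (a b c f : ℕ) : ℕ × ℕ := if f = a then (b, c) else if f = b then (a, c) else (a, b)

namespace PKind

/-- Index validity. -/
def ok : PKind → Bool
  | hub3 a b => decide (a ∈ [1, 2, 3, 4]) && decide (b ∈ [1, 2, 3, 4]) && decide (a < b)
  | rel3 a b c f => decide (a ∈ [1, 2, 3, 4]) && decide (b ∈ [1, 2, 3, 4]) && decide (c ∈ [1, 2, 3, 4]) &&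
      decide (a < b) && decide (b < c) && (decide (f = a) || decide (f = b) || decide (f = c))
  | iso4 a b => decide (a ∈ [1, 2, 3, 4]) && decide (b ∈ [1, 2, 3, 4]) && decide (a < b)
  | hub4 a b c f => decide (a ∈ [1, 2, 3, 4]) && decide (b ∈ [1, 2, 3, 4]) && decide (c ∈ [1, 2, 3, 4]) &&
      decide (a < b) && decide (b < c) && (decide (f = a) || decide (f = b) || decide (f = c))
  | iso5 a b => decide (a ∈ [1, 2, 3, 4]) && decide (b ∈ [1, 2, 3, 4]) && decide (a < b)

/-- The isolated-set functional `u`. -/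
def uφ : PKind → DType → ℤ
  | hub3 a b => fun τ => τ.uZ [0, a, b]
  | rel3 a b c _ => fun τ => τ.uZ [a, b, c]
  | iso4 _ _ => fun τ => τ.uZ [1, 2, 3, 4]
  | hub4 a b c _ => fun τ => τ.uZ [0, a, b, c]
  | iso5 _ _ => fun τ => τ.uZ [0, 1, 2, 3, 4]

/-- First support functional. -/
def s1φ : PKind → DType → ℤ
  | hub3 a b => fun τ => ind (τ.piSupp a b)
  | rel3 a b c f => fun τ => ind (τ.rho [a, b, c] (others3 a b c f).1)
  | iso4 a _ => combo [(1, fun τ => ind (τ.isS a)), (1, fun τ => ind (τ.isT a))]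
  | hub4 a b c f => fun τ => ind (τ.rho [0, a, b, c] (others3 a b c f).1)
  | iso5 a _ => fun τ => ind (τ.rho [0, 1, 2, 3, 4] a)

/-- Second support functional. -/
def s2φ : PKind → DType → ℤ
  | hub3 a b => fun τ => ind (τ.piSupp b a)
  | rel3 a b c f => fun τ => ind (τ.rho [a, b, c] (others3 a b c f).2)
  | iso4 _ b => combo [(1, fun τ => ind (τ.isS b)), (1, fun τ => ind (τ.isT b))]
  | hub4 a b c f => fun τ => ind (τ.rho [0, a, b, c] (others3 a b c f).2)
  | iso5 _ b => fun τ => ind (τ.rho [0, 1, 2, 3, 4] b)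

/-- Lower bracket of the exponent `q` (`q₃`, `p`, or `2/5` exactly). -/
def QL : PKind → ℚ
  | hub3 _ _ => QL3
  | rel3 _ _ _ _ => QL3
  | iso4 _ _ => QL4
  | hub4 _ _ _ _ => QL4
  | iso5 _ _ => 2 / 5
/-- Upper bracket of the exponent `q`. -/
def QU : PKind → ℚ
  | hub3 _ _ => QU3
  | rel3 _ _ _ _ => QU3
  | iso4 _ _ => QU4
  | hub4 _ _ _ _ => QU4
  | iso5 _ _ => 2 / 5
/-- Certified upper bound of `(a·b)^q = θ^{i+j}` (`θ = θ₃, θ₄, λ`) at the support point `(2^{i/32}, 2^{j/32})`. -/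
def Pu : PKind → ℤ → ℚ
  | hub3 _ _ => powUp TH3L TH3U
  | rel3 _ _ _ _ => powUp TH3L TH3U
  | iso4 _ _ => powUp TH4L TH4U
  | hub4 _ _ _ _ => powUp TH4L TH4U
  | iso5 _ _ => powUp LAML LAMU
/-- Certified upper bound of the root-form constant `C = (M^{b}·R)^{q}` for `M ≤ 2^{−k/32}`:
`θ₃^{−3k}η^{k}` (· `θ₃^{32}` for a relay triple), `θ₄^{−4k}η^{k}` (· `θ₄^{64}` for `{1,2,3,4}`), `η^{−k}` (ISO₅: `C = M`). -/
def Cu (k : ℕ) : PKind → ℚ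
  | hub3 _ _ => powUp TH3L TH3U (-(3 * (k : ℤ))) * powUp ETAL ETAU k
  | rel3 _ _ _ _ => powUp TH3L TH3U (-(3 * (k : ℤ))) * powUp ETAL ETAU k * TH3U ^ 32
  | iso4 _ _ => powUp TH4L TH4U (-(4 * (k : ℤ))) * powUp ETAL ETAU k * TH4U ^ 64
  | hub4 _ _ _ _ => powUp TH4L TH4U (-(4 * (k : ℤ))) * powUp ETAL ETAU k
  | iso5 _ _ => powUp ETAL ETAU (-(k : ℤ))

end PKind

/-- A tangent row: power row `kind`, support point `(2^{i/32}, 2^{j/32})`, emitted row `N·u − G₁·s − G₂·t ≤ H`. -/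
structure TRow where
  /-- the power row -/
  kind : PKind
  /-- grid exponent of the first support -/
  i : ℤ
  /-- grid exponent of the second support -/
  j : ℤ
  /-- scale of `u` -/
  N : ℕ
  /-- scaled coefficient of the first support -/
  G1 : ℕ
  /-- scaled coefficient of the second support -/
  G2 : ℕ
  /-- right-hand side -/
  H : ℚ

/-- The LP row of a tangent row. -/
def TRow.toRow (r : TRow) : Row :=
  ⟨combo [((r.N : ℤ), r.kind.uφ), (-(r.G1 : ℤ), r.kind.s1φ), (-(r.G2 : ℤ), r.kind.s2φ)], r.H⟩

/-- **The cut check** (pure `ℚ`): indices valid, `N > 0`, and `(H, G₁, G₂)/N` dominate the certified tangent data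
`Cu·Pu·(1−2q_lo)`, `Cu·q_hi·Pu·η^{−i}`, `Cu·q_hi·Pu·η^{−j}`. -/
def TRow.ok (k : ℕ) (r : TRow) : Bool :=
  r.kind.ok && decide (0 < r.N) &&
    decide (r.kind.Cu k * r.kind.Pu (r.i + r.j) * (1 - 2 * r.kind.QL) ≤ r.H / r.N) &&
    decide (r.kind.Cu k * r.kind.QU * r.kind.Pu (r.i + r.j) * powUp ETAL ETAU (-r.i) ≤ (r.G1 : ℚ) / r.N) &&
    decide (r.kind.Cu k * r.kind.QU * r.kind.Pu (r.i + r.j) * powUp ETAL ETAU (-r.j) ≤ (r.G2 : ℚ) / r.N)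

/-- Rows of template B: a template-A row, the JUNK row `S_z − T_z + e − j_z ≤ 0` of relay `z` (LEMMA B (iii):
`S_z ≤ x(CTRL_z) + x(J_z)`, `x(CTRL_z) ≤ T_z − E`), or a tangent row. -/
inductive BRow where
  /-- a row of template A -/
  | base (r : FRow)
  /-- the junk row of relay `z` -/
  | junk (z : ℕ)
  /-- a tangent row of a power row -/
  | tan (r : TRow)

/-- The LP row. -/
def BRow.toRow : BRow → Row
  | base r => TypeTable.toRow r
  | junk z => ⟨combo [(1, fun τ => ind (τ.isS z)), (-1, fun τ => ind (τ.isT z)), (1, eZ), (-1, fun τ => ind (τ.junk z))], 0⟩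
  | tan r => r.toRow

/-- Row validity for the case `cs` at hub weights `M ≤ 2^{−k/32}`. -/
def BRow.ok (cs : FMCase) (k : ℕ) : BRow → Bool
  | base r => rowOK cs r
  | junk z => decide (z ∈ [1, 2, 3, 4])
  | tan r => r.ok k

/-- **The programme check of template B.** -/
def checkFMB (cs : FMCase) (k : ℕ) (ks : List BRow) (y : List ℚ) (V : ℚ) : Bool :=
  ks.all (BRow.ok cs k) && decide (0 ≤ V) && checkCert eZ (ks.map BRow.toRow) y V

/-! ### Certification of the grid constants -/

noncomputable section

/-- `η = 2^{1/32} ∈ [ETAL, ETAU]`. -/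
theorem eta_bounds : ((ETAL : ℚ) : ℝ) ≤ (2 : ℝ) ^ ((1 : ℝ) / 32) ∧ (2 : ℝ) ^ ((1 : ℝ) / 32) ≤ ((ETAU : ℚ) : ℝ) := by
  have e : ((2 : ℚ) : ℝ) = 2 := by norm_num
  constructor
  · have h := RpowCert.rpow_ge_cert (t := 2) (R := ETAL) (α := (1 : ℝ) / 32) (a := 1) (b := 32) (by norm_num)
      (by norm_num) (Or.inr ⟨by norm_num, by norm_num⟩) (by decide +kernel)
    rwa [e] at h
  · have h := RpowCert.rpow_le_cert (t := 2) (R := ETAU) (α := (1 : ℝ) / 32) (a := 1) (b := 32) (by norm_num)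
      (by decide +kernel) (by norm_num) (Or.inr ⟨by norm_num, by norm_num⟩) (by decide +kernel)
    rwa [e] at h

/-- `λ = 2^{1/80} = 2^{(2/5)/32} ∈ [LAML, LAMU]`. -/
theorem lam_bounds : ((LAML : ℚ) : ℝ) ≤ (2 : ℝ) ^ (((5 : ℝ) / 2)⁻¹ / 32) ∧ (2 : ℝ) ^ (((5 : ℝ) / 2)⁻¹ / 32) ≤ ((LAMU : ℚ) : ℝ) := by
  have e : ((2 : ℚ) : ℝ) = 2 := by norm_num
  have eα : ((5 : ℝ) / 2)⁻¹ / 32 = ((1 : ℤ) : ℝ) / ((80 : ℕ) : ℝ) := by norm_num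
  constructor
  · have h := RpowCert.rpow_ge_cert (t := 2) (R := LAML) (α := ((5 : ℝ) / 2)⁻¹ / 32) (a := 1) (b := 80) (by norm_num)
      (by norm_num) (Or.inr ⟨by norm_num, by rw [eα]⟩) (by decide +kernel)
    rwa [e] at h
  · have h := RpowCert.rpow_le_cert (t := 2) (R := LAMU) (α := ((5 : ℝ) / 2)⁻¹ / 32) (a := 1) (b := 80) (by norm_num)
      (by decide +kernel) (by norm_num) (Or.inr ⟨by norm_num, by rw [eα]⟩) (by decide +kernel)
    rwa [e] at h

/-- `θ₃ = 2^{q₃/32} ∈ [TH3L, TH3U]`. -/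
theorem theta3_bounds : ((TH3L : ℚ) : ℝ) ≤ (2 : ℝ) ^ (((3 + Real.sqrt 3) / 2)⁻¹ / 32) ∧
    (2 : ℝ) ^ (((3 + Real.sqrt 3) / 2)⁻¹ / 32) ≤ ((TH3U : ℚ) : ℝ) := by
  have e : ((2 : ℚ) : ℝ) = 2 := by norm_num
  obtain ⟨h1, h2⟩ := RpowCert.inv_c3_bounds
  constructor
  · have h := RpowCert.rpow_ge_cert (t := 2) (R := TH3L) (α := ((3 + Real.sqrt 3) / 2)⁻¹ / 32) (a := 101)
      (b := 7647) (by norm_num) (by norm_num) (Or.inr ⟨by norm_num, by push_cast; linarith⟩) (by decide +kernel)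
    rwa [e] at h
  · have h := RpowCert.rpow_le_cert (t := 2) (R := TH3U) (α := ((3 + Real.sqrt 3) / 2)⁻¹ / 32) (a := 94)
      (b := 7117) (by norm_num) (by decide +kernel) (by norm_num) (Or.inr ⟨by norm_num, by push_cast; linarith⟩)
      (by decide +kernel)
    rwa [e] at h

/-- `θ₄ = 2^{p/32} ∈ [TH4L, TH4U]`. -/
theorem theta4_bounds : ((TH4L : ℚ) : ℝ) ≤ (2 : ℝ) ^ (((3 + Real.sqrt (11 / 3)) / 2)⁻¹ / 32) ∧
    (2 : ℝ) ^ (((3 + Real.sqrt (11 / 3)) / 2)⁻¹ / 32) ≤ ((TH4U : ℚ) : ℝ) := by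
  have e : ((2 : ℚ) : ℝ) = 2 := by norm_num
  obtain ⟨h1, h2⟩ := RpowCert.inv_c4_bounds
  constructor
  · have h := RpowCert.rpow_ge_cert (t := 2) (R := TH4L) (α := ((3 + Real.sqrt (11 / 3)) / 2)⁻¹ / 32) (a := 69)
      (b := 5426) (by norm_num) (by norm_num) (Or.inr ⟨by norm_num, by push_cast; linarith⟩) (by decide +kernel)
    rwa [e] at h
  · have h := RpowCert.rpow_le_cert (t := 2) (R := TH4U) (α := ((3 + Real.sqrt (11 / 3)) / 2)⁻¹ / 32) (a := 80)
      (b := 6291) (by norm_num) (by decide +kernel) (by norm_num) (Or.inr ⟨by norm_num, by push_cast; linarith⟩)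
      (by decide +kernel)
    rwa [e] at h

/-! ### Grid lemmas -/

/-- `x ∈ [lo, hi]`, `lo > 0` ⟹ `x^m ≤ powUp lo hi m`. -/
theorem le_powUp {lo hi : ℚ} {x : ℝ} (hlo : 0 < lo) (h1 : (lo : ℝ) ≤ x) (h2 : x ≤ hi) (m : ℤ) :
    x ^ m ≤ ((powUp lo hi m : ℚ) : ℝ) := by
  have hlo' : (0 : ℝ) < lo := by exact_mod_cast hlo
  have hx : 0 < x := lt_of_lt_of_le hlo' h1
  by_cases hm : 0 ≤ m
  · have em : x ^ m = x ^ m.toNat := by rw [← zpow_natCast, Int.toNat_of_nonneg hm]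
    simp only [powUp, hm, ↓reduceIte, em]
    push_cast
    exact pow_le_pow_left₀ hx.le h2 _
  · have em : x ^ m = (x ^ (-m).toNat)⁻¹ := by
      rw [← zpow_natCast, Int.toNat_of_nonneg (by omega), zpow_neg, inv_inv]
    simp only [powUp, hm, ↓reduceIte, em]
    push_cast
    exact inv_anti₀ (pow_pos hlo' _) (pow_le_pow_left₀ hlo'.le h1 _)

/-- Grid powers: `2^{(α/32)·m} = (2^{α/32})^m ≤ powUp lo hi m` for a bracket `[lo,hi] ∋ 2^{α/32}`. -/
theorem grid_le {α : ℝ} {lo hi : ℚ} (hlo : 0 < lo) (h1 : (lo : ℝ) ≤ (2 : ℝ) ^ (α / 32))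
    (h2 : (2 : ℝ) ^ (α / 32) ≤ hi) (m : ℤ) : (2 : ℝ) ^ (α / 32 * m) ≤ ((powUp lo hi m : ℚ) : ℝ) := by
  rw [Real.rpow_mul (by norm_num : (0 : ℝ) ≤ 2), Real.rpow_intCast]
  exact le_powUp hlo h1 h2 m

/-- `ETAL > 0`. -/
theorem ETAL_pos : 0 < ETAL := by decide +kernel

/-- The scaled constant on the grid: `0 < M ≤ 2^{−k/32}`, `c > 0`, `n·c⁻¹ − 1 ≥ 0` (`n = 3, 4`) ⟹
`(M^{n−c})^{c⁻¹} ≤ θ^{−n k}·η^{k}` for brackets `θ ∋ 2^{c⁻¹/32}`, `η ∋ 2^{1/32}`. -/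
theorem scaled_const_le {M c : ℝ} {k n : ℕ} {tl tu : ℚ} (hM : 0 < M) (hMk : M ≤ (2 : ℝ) ^ (-(k : ℝ) / 32))
    (hc : 0 < c) (hn : 0 ≤ n * c⁻¹ - 1) (htl : 0 < tl) (ht1 : (tl : ℝ) ≤ (2 : ℝ) ^ (c⁻¹ / 32))
    (ht2 : (2 : ℝ) ^ (c⁻¹ / 32) ≤ tu) :
    (M ^ ((n : ℝ) - c)) ^ c⁻¹ ≤ ((powUp tl tu (-(n * (k : ℤ))) * powUp ETAL ETAU k : ℚ) : ℝ) := by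
  have hc0 : c ≠ 0 := ne_of_gt hc
  have e1 : ((n : ℝ) - c) * c⁻¹ = n * c⁻¹ - 1 := by field_simp
  rw [← Real.rpow_mul hM.le, e1]
  have h1 : M ^ ((n : ℝ) * c⁻¹ - 1) ≤ ((2 : ℝ) ^ (-(k : ℝ) / 32)) ^ ((n : ℝ) * c⁻¹ - 1) :=
    Real.rpow_le_rpow hM.le hMk hn
  have e2 : ((2 : ℝ) ^ (-(k : ℝ) / 32)) ^ ((n : ℝ) * c⁻¹ - 1) =
      (2 : ℝ) ^ (c⁻¹ / 32 * ((-(n * (k : ℤ)) : ℤ) : ℝ)) * (2 : ℝ) ^ ((1 : ℝ) / 32 * ((k : ℤ) : ℝ)) := by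
    rw [← Real.rpow_mul (by norm_num : (0 : ℝ) ≤ 2), ← Real.rpow_add (by norm_num : (0 : ℝ) < 2)]
    congr 1; push_cast; ring
  rw [e2] at h1
  refine h1.trans ?_
  rw [Rat.cast_mul]
  exact mul_le_mul (grid_le htl ht1 ht2 _) (grid_le ETAL_pos eta_bounds.1 eta_bounds.2 _) (by positivity)
    ((by positivity : (0 : ℝ) ≤ (2 : ℝ) ^ (c⁻¹ / 32 * ((-(n * (k : ℤ)) : ℤ) : ℝ))).trans (grid_le htl ht1 ht2 _))

/-- The ISO₅ constant on the grid: `(M^{5/2})^{2/5} = M ≤ 2^{−k/32} = η^{−k}`. -/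
theorem iso5_const_le {M : ℝ} {k : ℕ} (hM : 0 < M) (hMk : M ≤ (2 : ℝ) ^ (-(k : ℝ) / 32)) :
    (M ^ ((5 : ℝ) / 2)) ^ ((5 : ℝ) / 2)⁻¹ ≤ ((powUp ETAL ETAU (-(k : ℤ)) : ℚ) : ℝ) := by
  rw [← Real.rpow_mul hM.le, mul_inv_cancel₀ (by norm_num : (5 : ℝ) / 2 ≠ 0), Real.rpow_one]
  have e : (2 : ℝ) ^ (-(k : ℝ) / 32) = (2 : ℝ) ^ ((1 : ℝ) / 32 * ((-(k : ℤ) : ℤ) : ℝ)) := by congr 1; push_cast; ring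
  rw [e] at hMk
  exact hMk.trans (grid_le ETAL_pos eta_bounds.1 eta_bounds.2 _)

/-- Support powers on the grid: `(2^{i/32}·2^{j/32})^{q} = θ^{i+j} ≤ powUp` for a bracket `θ ∋ 2^{q/32}`. -/
theorem supp_pow_le {q : ℝ} {tl tu : ℚ} (htl : 0 < tl) (ht1 : (tl : ℝ) ≤ (2 : ℝ) ^ (q / 32))
    (ht2 : (2 : ℝ) ^ (q / 32) ≤ tu) (i j : ℤ) :
    ((2 : ℝ) ^ ((i : ℝ) / 32) * (2 : ℝ) ^ ((j : ℝ) / 32)) ^ q ≤ ((powUp tl tu (i + j) : ℚ) : ℝ) := by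
  have e : ((2 : ℝ) ^ ((i : ℝ) / 32) * (2 : ℝ) ^ ((j : ℝ) / 32)) ^ q = (2 : ℝ) ^ (q / 32 * ((i + j : ℤ) : ℝ)) := by
    rw [← Real.rpow_add (by norm_num : (0 : ℝ) < 2), ← Real.rpow_mul (by norm_num : (0 : ℝ) ≤ 2)]
    congr 1; push_cast; ring
  rw [e]; exact grid_le htl ht1 ht2 _

/-- Inverse support on the grid: `(2^{i/32})⁻¹ = η^{−i} ≤ powUp ETAL ETAU (−i)`. -/
theorem inv_supp_le (i : ℤ) : ((2 : ℝ) ^ ((i : ℝ) / 32))⁻¹ ≤ ((powUp ETAL ETAU (-i) : ℚ) : ℝ) := by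
  have e : ((2 : ℝ) ^ ((i : ℝ) / 32))⁻¹ = (2 : ℝ) ^ ((1 : ℝ) / 32 * ((-i : ℤ) : ℝ)) := by
    rw [← Real.rpow_neg (by norm_num : (0 : ℝ) ≤ 2)]; congr 1; push_cast; ring
  rw [e]; exact grid_le ETAL_pos eta_bounds.1 eta_bounds.2 _

/-- The fixed-factor powers: `2^{q} = θ^{32} ≤ tu^32` and `4^{q} = θ^{64} ≤ tu^64` for `θ = 2^{q/32} ≤ tu`. -/
theorem R_pow_le {q : ℝ} {tu : ℚ} (ht2 : (2 : ℝ) ^ (q / 32) ≤ tu) :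
    (2 : ℝ) ^ q ≤ ((tu ^ 32 : ℚ) : ℝ) ∧ (4 : ℝ) ^ q ≤ ((tu ^ 64 : ℚ) : ℝ) := by
  have h0 : (0 : ℝ) ≤ (2 : ℝ) ^ (q / 32) := by positivity
  constructor
  · have e : (2 : ℝ) ^ q = ((2 : ℝ) ^ (q / 32)) ^ (32 : ℕ) := by
      rw [← Real.rpow_natCast, ← Real.rpow_mul (by norm_num : (0 : ℝ) ≤ 2)]; congr 1; push_cast; ring
    rw [e]; push_cast; exact pow_le_pow_left₀ h0 ht2 _
  · have e : (4 : ℝ) ^ q = ((2 : ℝ) ^ (q / 32)) ^ (64 : ℕ) := by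
      rw [show (4 : ℝ) = (2 : ℝ) ^ (2 : ℕ) by norm_num, ← Real.rpow_natCast, ← Real.rpow_mul (by norm_num : (0:ℝ) ≤ 2),
        ← Real.rpow_natCast, ← Real.rpow_mul (by norm_num : (0 : ℝ) ≤ 2)]
      congr 1; push_cast; ring
    rw [e]; push_cast; exact pow_le_pow_left₀ h0 ht2 _

end

end TypeTable
end HubOnly

end Summit.CriticalPhenomena.PercolationContinuityZ3.Theorems
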